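import Mathlib.Analysis.SpecialFunctions.ImproperIntegrals
import Mathlib.Analysis.SpecialFunctions.Log.Deriv
import Mathlib.MeasureTheory.Integral.DominatedConvergence
import Literature.Analysis.SpecialFunctions.BesselJZeroFermiIntegral
import HarnessLib

/-!
# The cosine transform of `log coth`: `∫₀^∞ log coth(x) cos(bx) dx = (π/(2b)) tanh(πb/4)`

For `x > 0` write `log coth x = log((1 + e^{-2x})/(1 - e^{-2x}))`.  This file proves the classical
half-line cosine transform of this (integrable, positive) kernel and its total mass:

* `hasSum_log_coth` — the series `log coth x = Σ_{k ≥ 0} (2/(2k+1)) e^{-2(2k+1)x}` (`x > 0`), from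
  Mathlib's `Real.hasSum_log_sub_log_of_abs_lt_one` at `q = e^{-2x}`;
* `integral_log_coth_mul_cos_eq_tsum` — term-wise integration
  (`MeasureTheory.integral_tsum_of_summable_integral_norm`; the `k`-th term has
  `∫₀^∞ |·| ≤ 1/(2k+1)²`): `∫₀^∞ log coth(x) cos(bx) dx = Σ_k 4/(4(2k+1)² + b²)`;
* `integral_log_coth_mul_cos` — for `b ≠ 0` the sum is `(π/(2b)) tanh(πb/4)` by the partial-fraction
  expansion of `tanh` (the tree's `hasSum_tanh`); `integral_log_coth` — for `b = 0` it is
  `Σ_k 1/(2k+1)² = π²/8` (the tree's `hasSum_one_div_odd_sq`);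
* `log_coth_nonneg`, `integrableOn_log_coth` — positivity and integrability on `(0, ∞)` (monotone
  convergence on the series: `∫⁻ = Σ 1/(2k+1)² < ∞`);
* `log_coth_le` — the elementary tail bound `log coth x ≤ 2e^{-2x}/(1 - e^{-2x}) = 2/(e^{2x} - 1)`
  (`log(1+u) ≤ u`).

These are exactly the scalar facts behind the quantum-belief-propagation weight
`f_β(t) = (2/(βπ)) log coth(π|t|/(2β))` of Hastings / Capel–Moscolari–Teufel–Wessel
(arXiv:2310.09182, eq. (10.1)–(10.2): `‖f_β‖₁ = 1`, `f̂_β(ω) = tanh(βω/2)/(βω/2)`, exponential tail),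
assembled in `Literature/MathematicalPhysics/QuantumLattice/QBPWeight.lean`.

## References

* I. S. Gradshteyn, I. M. Ryzhik, *Table of Integrals, Series, and Products*, 8th ed. (2015),
  §4.37–4.38 (integrals of logarithms of hyperbolic functions). [GradshteynRyzhik2015]
* Á. Capel, M. Moscolari, S. Teufel, T. Wessel, Commun. Math. Phys. 406 (2025) 43 =
  arXiv:2310.09182, §10.1.1, eq. (10.1)–(10.2). [CapelEtAl2023]
* A. Anshu, S. Arunachalam, T. Kuwahara, M. Soleimanifar, Nature Physics 17 (2021) 931,
  Supplementary Information (the explicit inverse Fourier transform). [AnshuEtAl2021]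
* G. E. Andrews, R. Askey, R. Roy, *Special Functions* (1999), §1.2 (1.2.5) (partial fractions of
  `π cot πz`, whence those of `tanh` — the tree's `TanhPartialFractions`). [AndrewsAskeyRoy1999]
-/

noncomputable section

open Real MeasureTheory Set Filter
open scoped Topology

namespace Literature.Analysis.SpecialFunctions

/-! ## §1 The series of `log coth` -/

/-- `0 < e^{-2x} < 1` for `x > 0`. [folklore] -/
private theorem exp_neg_two_mul_lt_one {x : ℝ} (hx : 0 < x) : Real.exp (-(2 * x)) < 1 := by
  rw [Real.exp_lt_one_iff]; linarith

/-- `x ↦ e^{-cx}` is integrable on `(0, ∞)` for `c > 0` (Mathlib's `exp_neg_integrableOn_Ioi`, with the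
product re-associated). [folklore] -/
private theorem integrableOn_exp_neg_mul' {c : ℝ} (hc : 0 < c) :
    IntegrableOn (fun x : ℝ => Real.exp (-(c * x))) (Ioi 0) :=
  (exp_neg_integrableOn_Ioi 0 hc).congr_fun (fun x _ => by simp only [neg_mul]) measurableSet_Ioi

/-- `∫₀^∞ e^{-cx} dx = 1/c` for `c > 0`. [folklore] -/
private theorem integral_exp_neg_mul' {c : ℝ} (hc : 0 < c) :
    ∫ x in Ioi (0 : ℝ), Real.exp (-(c * x)) = 1 / c := by
  have h := integral_exp_mul_Ioi (a := -c) (by linarith) 0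
  have h' : ∫ x in Ioi (0 : ℝ), Real.exp (-(c * x)) = ∫ x in Ioi (0 : ℝ), Real.exp (-c * x) := by
    congr 1; funext x; rw [neg_mul]
  rw [h', h, mul_zero, Real.exp_zero, neg_div_neg_eq]

/-- **`log coth x = Σ_{k ≥ 0} (2/(2k+1)) e^{-2(2k+1)x}`** for `x > 0`
(`log((1+q)/(1-q)) = 2 Σ_k q^{2k+1}/(2k+1)` at `q = e^{-2x}`; Mathlib's
`Real.hasSum_log_sub_log_of_abs_lt_one`). [cite: GradshteynRyzhik2015, 1.513 1.] -/
theorem hasSum_log_coth {x : ℝ} (hx : 0 < x) :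
    HasSum (fun k : ℕ => 2 / (2 * (k : ℝ) + 1) * Real.exp (-(2 * (2 * (k : ℝ) + 1) * x)))
      (Real.log ((1 + Real.exp (-(2 * x))) / (1 - Real.exp (-(2 * x))))) := by
  set q := Real.exp (-(2 * x)) with hq
  have hq0 : 0 < q := Real.exp_pos _
  have hq1 : q < 1 := exp_neg_two_mul_lt_one hx
  have h := Real.hasSum_log_sub_log_of_abs_lt_one (x := q) (by rwa [abs_of_pos hq0])
  rw [Real.log_div (by linarith) (by linarith)]
  convert h using 1
  funext k
  have hpow : q ^ (2 * k + 1) = Real.exp (-(2 * (2 * (k : ℝ) + 1) * x)) := by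
    rw [hq, ← Real.exp_nat_mul]
    congr 1
    push_cast
    ring
  rw [hpow]
  ring

/-- The terms of the series are nonnegative. [folklore] -/
private theorem log_coth_term_nonneg (k : ℕ) (x : ℝ) :
    0 ≤ 2 / (2 * (k : ℝ) + 1) * Real.exp (-(2 * (2 * (k : ℝ) + 1) * x)) := by
  positivity

/-- **`log coth x ≥ 0`** for `x > 0` (so the QBP weight `f_β` of CMTW (10.1) is nonnegative and
`‖f_β‖₁ = ∫ f_β`). [cite: CapelEtAl2023, §10.1.1 eq. (10.1)–(10.2)] -/
theorem log_coth_nonneg {x : ℝ} (hx : 0 < x) :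
    0 ≤ Real.log ((1 + Real.exp (-(2 * x))) / (1 - Real.exp (-(2 * x)))) :=
  (hasSum_log_coth hx).nonneg fun k => log_coth_term_nonneg k x

/-- **Tail bound** `log coth x ≤ 2e^{-2x}/(1 - e^{-2x})` for `x > 0` (`log(1+u) ≤ u` with
`(1+q)/(1-q) = 1 + 2q/(1-q)`); Capel–Moscolari–Teufel–Wessel (10.2).
[cite: CapelEtAl2023, eq. (10.2)] -/
theorem log_coth_le {x : ℝ} (hx : 0 < x) :
    Real.log ((1 + Real.exp (-(2 * x))) / (1 - Real.exp (-(2 * x)))) ≤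
      2 * Real.exp (-(2 * x)) / (1 - Real.exp (-(2 * x))) := by
  set q := Real.exp (-(2 * x)) with hq
  have hq0 : 0 < q := Real.exp_pos _
  have hq1 : q < 1 := exp_neg_two_mul_lt_one hx
  have h1q : 0 < 1 - q := by linarith
  have heq : (1 + q) / (1 - q) = 1 + 2 * q / (1 - q) := by
    field_simp; ring
  rw [heq]
  exact Real.log_le_sub_one_of_pos (by positivity) |>.trans (by linarith)

/-! ## §2 Term-wise integrals -/

/-- The `k`-th term times `cos(bx)` is integrable on `(0, ∞)`. [folklore] -/
private theorem integrableOn_log_coth_term_mul_cos (k : ℕ) (b : ℝ) :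
    IntegrableOn (fun x => 2 / (2 * (k : ℝ) + 1) * Real.exp (-(2 * (2 * (k : ℝ) + 1) * x)) *
      Real.cos (b * x)) (Ioi 0) := by
  have hc : (0 : ℝ) < 2 * (2 * (k : ℝ) + 1) := by positivity
  have hI := (integrableOn_exp_neg_mul' hc).const_mul (2 / (2 * (k : ℝ) + 1))
  refine hI.mono' (by fun_prop : Continuous fun x => 2 / (2 * (k : ℝ) + 1) *
      Real.exp (-(2 * (2 * (k : ℝ) + 1) * x)) * Real.cos (b * x)).aestronglyMeasurable
    (Eventually.of_forall fun x => ?_)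
  rw [Real.norm_eq_abs, abs_mul, abs_of_nonneg (log_coth_term_nonneg k x)]
  exact mul_le_of_le_one_right (log_coth_term_nonneg k x) (Real.abs_cos_le_one _)

/-- `∫₀^∞ (2/(2k+1)) e^{-2(2k+1)x} cos(bx) dx = 4/(4(2k+1)² + b²)` (the Laplace transform of the
cosine, `∫₀^∞ e^{-cx} cos(bx) dx = c/(c² + b²)`, the tree's `integral_exp_neg_mul_cos`). [folklore] -/
private theorem integral_log_coth_term_mul_cos (k : ℕ) (b : ℝ) :
    ∫ x in Ioi (0 : ℝ), 2 / (2 * (k : ℝ) + 1) * Real.exp (-(2 * (2 * (k : ℝ) + 1) * x)) *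
      Real.cos (b * x) = 4 / (4 * (2 * (k : ℝ) + 1) ^ 2 + b ^ 2) := by
  have hc : (0 : ℝ) < 2 * (2 * (k : ℝ) + 1) := by positivity
  have hfun : (fun x : ℝ => 2 / (2 * (k : ℝ) + 1) * Real.exp (-(2 * (2 * (k : ℝ) + 1) * x)) *
      Real.cos (b * x)) = fun x => 2 / (2 * (k : ℝ) + 1) * (Real.exp (-(2 * (2 * (k : ℝ) + 1) * x)) *
        Real.cos (b * x)) := by
    funext x; ring
  rw [hfun, integral_const_mul, integral_exp_neg_mul_cos hc b]
  have hk : (2 * (k : ℝ) + 1) ≠ 0 := by positivity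
  field_simp
  ring

/-- `∫₀^∞ |(2/(2k+1)) e^{-2(2k+1)x} cos(bx)| dx ≤ 1/(2k+1)²`. [folklore] -/
private theorem integral_norm_log_coth_term_mul_cos_le (k : ℕ) (b : ℝ) :
    ∫ x in Ioi (0 : ℝ), ‖2 / (2 * (k : ℝ) + 1) * Real.exp (-(2 * (2 * (k : ℝ) + 1) * x)) *
      Real.cos (b * x)‖ ≤ 1 / (2 * (k : ℝ) + 1) ^ 2 := by
  have hc : (0 : ℝ) < 2 * (2 * (k : ℝ) + 1) := by positivity
  have hI := (integrableOn_exp_neg_mul' hc).const_mul (2 / (2 * (k : ℝ) + 1))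
  have hle : ∫ x in Ioi (0 : ℝ), ‖2 / (2 * (k : ℝ) + 1) * Real.exp (-(2 * (2 * (k : ℝ) + 1) * x)) *
      Real.cos (b * x)‖ ≤ ∫ x in Ioi (0 : ℝ), 2 / (2 * (k : ℝ) + 1) *
        Real.exp (-(2 * (2 * (k : ℝ) + 1) * x)) := by
    refine integral_mono (integrableOn_log_coth_term_mul_cos k b).norm hI fun x => ?_
    dsimp only
    rw [Real.norm_eq_abs, abs_mul, abs_of_nonneg (log_coth_term_nonneg k x)]
    exact mul_le_of_le_one_right (log_coth_term_nonneg k x) (Real.abs_cos_le_one _)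
  refine hle.trans (le_of_eq ?_)
  rw [integral_const_mul, integral_exp_neg_mul' hc]
  have hk : (2 * (k : ℝ) + 1) ≠ 0 := by positivity
  field_simp

/-! ## §3 The cosine transform as a series, and its evaluation -/

/-- **`∫₀^∞ log coth(x) cos(bx) dx = Σ_{k ≥ 0} 4/(4(2k+1)² + b²)`** (term-wise integration of the
series of §1, justified by `Σ_k ∫|term_k| ≤ Σ_k 1/(2k+1)² < ∞`).
[cite: GradshteynRyzhik2015, §4.37] -/
theorem integral_log_coth_mul_cos_eq_tsum (b : ℝ) :
    ∫ x in Ioi (0 : ℝ), Real.log ((1 + Real.exp (-(2 * x))) / (1 - Real.exp (-(2 * x)))) *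
      Real.cos (b * x) = ∑' k : ℕ, 4 / (4 * (2 * (k : ℝ) + 1) ^ 2 + b ^ 2) := by
  have hF_int := fun k => integrableOn_log_coth_term_mul_cos k b
  have hF_sum : Summable fun k : ℕ => ∫ x in Ioi (0 : ℝ), ‖2 / (2 * (k : ℝ) + 1) *
      Real.exp (-(2 * (2 * (k : ℝ) + 1) * x)) * Real.cos (b * x)‖ := by
    refine Summable.of_nonneg_of_le (fun k => integral_nonneg fun x => norm_nonneg _)
      (fun k => integral_norm_log_coth_term_mul_cos_le k b) ?_
    exact hasSum_one_div_odd_sq.summable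
  have h := integral_tsum_of_summable_integral_norm hF_int hF_sum
  simp_rw [integral_log_coth_term_mul_cos] at h
  rw [h]
  refine setIntegral_congr_fun measurableSet_Ioi fun x hx => ?_
  exact (((hasSum_log_coth hx).mul_right (Real.cos (b * x))).tsum_eq).symm

/-- `Σ_{k ≥ 0} 4/(4(2k+1)² + b²) = (π/(2b)) tanh(πb/4)` for `b ≠ 0` (the partial-fraction expansion of
`tanh`, the tree's `hasSum_tanh` at `πb/4`). [cite: AndrewsAskeyRoy1999, §1.2 (1.2.5)] -/
theorem hasSum_four_div_sq_add_sq {b : ℝ} (hb : b ≠ 0) :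
    HasSum (fun k : ℕ => 4 / (4 * (2 * (k : ℝ) + 1) ^ 2 + b ^ 2))
      (π / (2 * b) * Real.tanh (π * b / 4)) := by
  have h := (hasSum_tanh (π * b / 4)).mul_left (π / (2 * b))
  have hfun : (fun k : ℕ => 4 / (4 * (2 * (k : ℝ) + 1) ^ 2 + b ^ 2)) = fun k : ℕ =>
      π / (2 * b) * (8 * (π * b / 4) / (4 * (π * b / 4) ^ 2 + (2 * (k : ℝ) + 1) ^ 2 * π ^ 2)) := by
    funext k
    have hπ : (π : ℝ) ≠ 0 := Real.pi_ne_zero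
    have hden : 4 * (2 * (k : ℝ) + 1) ^ 2 + b ^ 2 ≠ 0 := by positivity
    have hden' : 4 * (π * b / 4) ^ 2 + (2 * (k : ℝ) + 1) ^ 2 * π ^ 2 ≠ 0 := by positivity
    field_simp
    ring
  rw [hfun]
  exact h

/-- **The cosine transform of `log coth`**: for `b ≠ 0`,
`∫₀^∞ log((1 + e^{-2x})/(1 - e^{-2x})) cos(bx) dx = (π/(2b)) tanh(πb/4)` — equivalently (CMTW
(10.1), `x = π|t|/(2β)`, `b = 2βω/π`) the QBP weight `f_β(t) = (2/(βπ)) log coth(π|t|/(2β))` has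
Fourier transform `tanh(βω/2)/(βω/2)`. [cite: CapelEtAl2023, §10.1.1 eq. (10.1)]
[cite: GradshteynRyzhik2015, §4.37] -/
theorem integral_log_coth_mul_cos {b : ℝ} (hb : b ≠ 0) :
    ∫ x in Ioi (0 : ℝ), Real.log ((1 + Real.exp (-(2 * x))) / (1 - Real.exp (-(2 * x)))) *
      Real.cos (b * x) = π / (2 * b) * Real.tanh (π * b / 4) := by
  rw [integral_log_coth_mul_cos_eq_tsum, (hasSum_four_div_sq_add_sq hb).tsum_eq]

/-- **Total mass**: `∫₀^∞ log((1 + e^{-2x})/(1 - e^{-2x})) dx = π²/8` (`= Σ_k 1/(2k+1)²`) —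
equivalently `‖f_β‖_{L¹} = 1` for the QBP weight of CMTW (10.1).
[cite: CapelEtAl2023, §10.1.1 eq. (10.1)–(10.2)] -/
theorem integral_log_coth :
    ∫ x in Ioi (0 : ℝ), Real.log ((1 + Real.exp (-(2 * x))) / (1 - Real.exp (-(2 * x)))) =
      π ^ 2 / 8 := by
  have h := integral_log_coth_mul_cos_eq_tsum 0
  simp only [zero_mul, Real.cos_zero, mul_one] at h
  rw [h, ← hasSum_one_div_odd_sq.tsum_eq]
  congr 1
  funext k
  have hk : (2 * (k : ℝ) + 1) ≠ 0 := by positivity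
  field_simp
  ring

/-! ## §4 Integrability on `(0, ∞)` -/

/-- **`log coth` is integrable on `(0, ∞)`** (monotone convergence on the series of §1:
`∫⁻ = Σ_k 1/(2k+1)² < ∞`); `f_β ∈ L¹` in CMTW §10.1.1. [cite: CapelEtAl2023, §10.1.1 eq. (10.1)–(10.2)] -/
theorem integrableOn_log_coth :
    IntegrableOn (fun x => Real.log ((1 + Real.exp (-(2 * x))) / (1 - Real.exp (-(2 * x)))))
      (Ioi 0) := by
  set L : ℝ → ℝ := fun x => Real.log ((1 + Real.exp (-(2 * x))) / (1 - Real.exp (-(2 * x))))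
    with hL
  set T : ℕ → ℝ → ℝ := fun k x => 2 / (2 * (k : ℝ) + 1) * Real.exp (-(2 * (2 * (k : ℝ) + 1) * x))
    with hT
  have hmeas : AEStronglyMeasurable L (volume.restrict (Ioi (0 : ℝ))) := by
    refine (Real.measurable_log.comp ?_).aestronglyMeasurable
    fun_prop
  refine ⟨hmeas, ?_⟩
  rw [hasFiniteIntegral_iff_enorm]
  -- term integrals
  have hTint : ∀ k, IntegrableOn (T k) (Ioi 0) := fun k =>
    (integrableOn_exp_neg_mul' (by positivity : (0 : ℝ) < 2 * (2 * (k : ℝ) + 1))).const_mul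
      (2 / (2 * (k : ℝ) + 1))
  have hTval : ∀ k : ℕ, ∫ x in Ioi (0 : ℝ), T k x = 1 / (2 * (k : ℝ) + 1) ^ 2 := by
    intro k
    have h := integral_log_coth_term_mul_cos k 0
    simp only [zero_mul, Real.cos_zero, mul_one] at h
    rw [hT]
    dsimp only
    rw [h]
    have hk : (2 * (k : ℝ) + 1) ≠ 0 := by positivity
    field_simp
    ring
  -- `∫⁻ ‖L‖ₑ = ∫⁻ Σ_k ofReal (T k)` on `(0, ∞)`
  have hpt : ∀ x ∈ Ioi (0 : ℝ), ‖L x‖ₑ = ∑' k, ENNReal.ofReal (T k x) := by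
    intro x hx
    have hx : (0 : ℝ) < x := hx
    rw [Real.enorm_eq_ofReal (log_coth_nonneg hx), ← (hasSum_log_coth hx).tsum_eq,
      ENNReal.ofReal_tsum_of_nonneg (fun k => log_coth_term_nonneg k x) (hasSum_log_coth hx).summable]
  rw [setLIntegral_congr_fun measurableSet_Ioi hpt,
    lintegral_tsum fun k => ((by fun_prop : Measurable (T k)).ennreal_ofReal).aemeasurable]
  have hk : ∀ k, ∫⁻ x in Ioi (0 : ℝ), ENNReal.ofReal (T k x) =
      ENNReal.ofReal (1 / (2 * (k : ℝ) + 1) ^ 2) := by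
    intro k
    rw [← ofReal_integral_eq_lintegral_ofReal (hTint k)
      (Eventually.of_forall fun x => log_coth_term_nonneg k x), hTval k]
  simp_rw [hk]
  rw [← ENNReal.ofReal_tsum_of_nonneg (fun k => by positivity) hasSum_one_div_odd_sq.summable]
  exact ENNReal.ofReal_lt_top

/-- `log coth · cos(b ·)` is integrable on `(0, ∞)` (the Fourier integrand of `f_β`).
[cite: CapelEtAl2023, §10.1.1 eq. (10.1)] -/
theorem integrableOn_log_coth_mul_cos (b : ℝ) :
    IntegrableOn (fun x => Real.log ((1 + Real.exp (-(2 * x))) / (1 - Real.exp (-(2 * x)))) *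
      Real.cos (b * x)) (Ioi 0) := by
  have h := integrableOn_log_coth.bdd_mul (c := 1)
    (by fun_prop : Continuous fun x : ℝ => Real.cos (b * x)).aestronglyMeasurable
    (Eventually.of_forall fun x => by
      rw [Real.norm_eq_abs]; exact Real.abs_cos_le_one _)
  exact IntegrableOn.congr_fun h (fun x _ => mul_comm _ _) measurableSet_Ioi

end Literature.Analysis.SpecialFunctions
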